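import Mathlib
import HarnessLib
import Literature.MathematicalPhysics.StatisticalMechanics.RenormalisationMapTermLipschitzSub
import Literature.MathematicalPhysics.StatisticalMechanics.RenormalisationMapLipschitzABKM
import Literature.MathematicalPhysics.StatisticalMechanics.RenormalisationMapCounting
import Literature.MathematicalPhysics.StatisticalMechanics.RenormalisationMapP2Fluct
import Literature.MathematicalPhysics.StatisticalMechanics.StrongWeightStepP1
import Literature.MathematicalPhysics.StatisticalMechanics.StrongNormExpLipschitz
import Literature.MathematicalPhysics.StatisticalMechanics.LinearisedMapABKMContraction

/-!
# The reblocked terms of the renormalisation map for the torus data with an ABSTRACT inner slot: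
# summed Lipschitz bound over sub-families ([ABKM19] Lemma 9.6 at first order — slot form)

`RenormalisationMapLipschitzSubABKM.tayNormLE_subsum_reblockTerm_sub_abkm` bounds the double sums
`Σ_{X∈𝓧'} Σ_{X₁∈𝓨(X)} (e^{−H̃})^{U∖X}(e^{H̃})^{X∖U}(1−e^{−H̃})^{X₁} · G(X∖X₁)` with the inner slot FIXED to
`G = R_{k+1}[P₂(e^{−H},K)]`.  The remaining pieces of the Lipschitz estimate of `S_k` (CH12-PLAN §5 (e2):
the block sum `Σ_B [(p_B−1)·blockTerm(B) + p_B·(D_B + (e^{−A_kH(B)}−1)(1−e^{−u_B}) − (e^{−u_B}−1+u_B))]` of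
`GradientRG.nextKStep_sub_opC_eq`, and the large-part pieces with `G = R[P₂ − K]`) have the SAME outer
structure with other inner slots.  This file is that theorem with the slot abstracted: the three block
factor families (`e^{−H̃}`, `e^{H̃}`, `1 − e^{−H̃}` and their primed versions, Lemma 9.3 bounds
`a₁ = a₂ = e^{1/4}`, `a₃ = 8e^{1/4}τ`, `δᵢ = 16e^{3/8}‖H̃−H̃'‖_{k,0}`), the block family `𝓑`, the gauge chain
`T_k^{B*}, T_k^{(X∖X₁)*} ≤ T_{k+1}^{U*}` and the weight inequality
`W_k^{U△X} W_k^{X₁} w_{k:k+1}^{X∖X₁} ≤ w_{k+1}^U` are discharged for the torus data exactly as there; the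
slot functionals `G, G'` enter through hypotheses in the concrete scale-`k` gauge `T_k^{(X∖X₁)*}` and
intermediate weight `w_{k:k+1}^{X∖X₁}`: bounds `g`, Lipschitz bounds `ρ`, smoothness, gauge locality.

* **`tayNormLE_subsum_reblockTerm_sub_abkm_slot`** — the slot form.

Everything is proved; no named fact.

## References
* S. Adams, S. Buchholz, R. Kotecký, S. Müller, arXiv:1910.13564, Lemma 9.6 (proof), Lemma 9.3,
  Lemma 8.3 (iii), Lemma 8.1, Theorem 7.1 (w5)–(w6) [AdamsBuchholzKoteckyMuller2019].
-/

noncomputable section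

namespace Literature.MathematicalPhysics.StatisticalMechanics.GradientRG

open scoped BigOperators Classical
open Finset Matrix
open Literature.MathematicalPhysics.StatisticalMechanics.TorusPolymer
  (IsPolymer blocks polys bprod blockOf thicken reblock mem_polys mem_blocks numBlocks isPolymer_blockOf
    thicken_mono thicken_mono_rad thicken_thicken subset_thicken)
open Literature.Barriers.CriticalPhenomena.LongRangePhi4.Polymer (IsConn components)
open Literature.MathematicalPhysics.QuantumFieldTheory

variable {d M : ℕ} [NeZero M]

/-- **The summed Lipschitz bound of the reblocked terms over sub-families, torus data, abstract inner
slot** ([ABKM19] Lemma 9.6 at first order).  Data as in `tayNormLE_subsum_reblockTerm_sub_abkm` except that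
the inner functionals `G(X∖X₁), G'(X∖X₁)` are arbitrary with `|G| ≤ g`, `|G − G'| ≤ ρ` in
`|·|_{T_k^{(X∖X₁)*}, w_{k:k+1}^{X∖X₁}}`, `C^{r₀}` and gauge-local; conclusion: the bound of
`tayNormLE_sum_reblockTerm_sub` with `a₁ = a₂ = e^{1/4}`, `a₃ = 8e^{1/4}τ`, `δᵢ = 16e^{3/8}‖H̃ − H̃'‖_{k,0}`.
[cite: AdamsBuchholzKoteckyMuller2019, Lemma 9.6 (proof, first order)] -/
theorem tayNormLE_subsum_reblockTerm_sub_abkm_slot {L N Mord R n p r₀ : ℕ} {θbar lam μ δ₁ δ₀ A𝒫 h A : ℝ}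
    {𝒞 : ℕ → (Fin d → ZMod M) → ℝ} (hd : 3 ≤ d) (hLodd : Odd L) (hL : 2 ^ (d + 3) + 16 * R ≤ L)
    (hR2 : 2 ≤ R) (hM : M = L ^ N) {k : ℕ} (hkN : k + 1 ≤ N) (hp : d / 2 + 1 ≤ p) (hMord : d / 2 + 1 ≤ Mord)
    (hB : AbkmWeightBounds L N Mord R n θbar lam μ δ₁ δ₀ A𝒫 𝒞
      (abkmWeightData L N Mord R θbar (schedDelta δ₀ δ₁ N) 𝒞))
    (hδ₀ : 0 < δ₀) (hδ₁ : 0 < δ₁) (hh : 0 < h) (hh0 : hZeroSq d R δ₀ δ₁ ≤ h ^ 2)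
    {U : Finset (Fin d → ZMod M)} (hU : IsPolymer (L ^ (k + 1)) U)
    {𝓧' : Finset (Finset (Fin d → ZMod M))}
    (h𝓧' : 𝓧' ⊆ (polys (L ^ k) univ).filter (fun X => reblock (L ^ k) (L * L ^ k) X = U))
    {𝓨 : Finset (Fin d → ZMod M) → Finset (Finset (Fin d → ZMod M))} (h𝓨 : ∀ X ∈ 𝓧', 𝓨 X ⊆ polys (L ^ k) X)
    {Ht Ht' : RelevantHamiltonian ℂ d} {τ : ℝ}
    (hHt : hamNorm (fieldWt h (L : ℝ) d k) ((L : ℝ) ^ k) (L ^ (d * k)) Ht ≤ τ)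
    (hHt' : hamNorm (fieldWt h (L : ℝ) d k) ((L : ℝ) ^ k) (L ^ (d * k)) Ht' ≤ τ) (hτ : τ ≤ 1 / 16)
    {Gs Gs' : Finset (Fin d → ZMod M) → ((Fin d → ZMod M) → ℝ) → ℂ} {g ρ : Finset (Fin d → ZMod M) → ℝ}
    (hSlot : ∀ X ∈ 𝓧', ∀ X₁ ∈ 𝓨 X, TayNormLE ((abkmNormParams L N Mord R p r₀ h θbar A (schedDelta δ₀ δ₁ N) 𝒞).gauge k (X \ X₁)) r₀ ((abkmWeightData L N Mord R θbar (schedDelta δ₀ δ₁ N) 𝒞).midWeight k (X \ X₁))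
      (Gs (X \ X₁)) (g (X \ X₁)))
    (hSlotΔ : ∀ X ∈ 𝓧', ∀ X₁ ∈ 𝓨 X, TayNormLE ((abkmNormParams L N Mord R p r₀ h θbar A (schedDelta δ₀ δ₁ N) 𝒞).gauge k (X \ X₁)) r₀ ((abkmWeightData L N Mord R θbar (schedDelta δ₀ δ₁ N) 𝒞).midWeight k (X \ X₁))
      (fun φ => Gs (X \ X₁) φ - Gs' (X \ X₁) φ) (ρ (X \ X₁)))
    (hSlotd : ∀ X ∈ 𝓧', ∀ X₁ ∈ 𝓨 X, ContDiff ℝ r₀ (Gs (X \ X₁)))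
    (hSlotd' : ∀ X ∈ 𝓧', ∀ X₁ ∈ 𝓨 X, ContDiff ℝ r₀ (Gs' (X \ X₁)))
    (hSlotloc : ∀ X ∈ 𝓧', ∀ X₁ ∈ 𝓨 X, IsGaugeLocal ((abkmNormParams L N Mord R p r₀ h θbar A (schedDelta δ₀ δ₁ N) 𝒞).gauge k (X \ X₁)) (Gs (X \ X₁)))
    (hSlotloc' : ∀ X ∈ 𝓧', ∀ X₁ ∈ 𝓨 X, IsGaugeLocal ((abkmNormParams L N Mord R p r₀ h θbar A (schedDelta δ₀ δ₁ N) 𝒞).gauge k (X \ X₁)) (Gs' (X \ X₁)))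
    (hSlotg : ∀ X ∈ 𝓧', ∀ X₁ ∈ 𝓨 X, 0 ≤ g (X \ X₁)) (hSlotρ : ∀ X ∈ 𝓧', ∀ X₁ ∈ 𝓨 X, 0 ≤ ρ (X \ X₁)) :
    TayNormLE ((abkmNormParams L N Mord R p r₀ h θbar A (schedDelta δ₀ δ₁ N) 𝒞).gauge (k + 1) U) r₀
      ((abkmWeightData L N Mord R θbar (schedDelta δ₀ δ₁ N) 𝒞).weight (k + 1) U)
      (fun φ => ∑ X ∈ 𝓧', ∑ X₁ ∈ 𝓨 X,
        (bprod (L ^ k) (fun B => expNegH Ht B φ) (U \ X) * bprod (L ^ k) (fun B => expNegH (-Ht) B φ) (X \ U) *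
            (bprod (L ^ k) (fun B => 1 - expNegH Ht B φ) X₁ * Gs (X \ X₁) φ) -
          bprod (L ^ k) (fun B => expNegH Ht' B φ) (U \ X) * bprod (L ^ k) (fun B => expNegH (-Ht') B φ) (X \ U) *
            (bprod (L ^ k) (fun B => 1 - expNegH Ht' B φ) X₁ * Gs' (X \ X₁) φ)))
      (∑ X ∈ 𝓧', ∑ X₁ ∈ 𝓨 X,
        (((∏ _B ∈ blocks (L ^ k) (U \ X), (Real.exp (1 / 4) +
              16 * Real.exp (3 / 8) * hamNorm (fieldWt h (L : ℝ) d k) ((L : ℝ) ^ k) (L ^ (d * k)) (Ht - Ht'))) -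
            ∏ _B ∈ blocks (L ^ k) (U \ X), Real.exp (1 / 4)) *
            (∏ _B ∈ blocks (L ^ k) (X \ U), Real.exp (1 / 4)) *
            ((∏ _B ∈ blocks (L ^ k) X₁, 8 * Real.exp (1 / 4) * τ) *
              g (X \ X₁)) +
          (∏ _B ∈ blocks (L ^ k) (U \ X), Real.exp (1 / 4)) *
            ((∏ _B ∈ blocks (L ^ k) (X \ U), (Real.exp (1 / 4) +
              16 * Real.exp (3 / 8) * hamNorm (fieldWt h (L : ℝ) d k) ((L : ℝ) ^ k) (L ^ (d * k)) (Ht - Ht'))) -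
              ∏ _B ∈ blocks (L ^ k) (X \ U), Real.exp (1 / 4)) *
            ((∏ _B ∈ blocks (L ^ k) X₁, 8 * Real.exp (1 / 4) * τ) *
              g (X \ X₁)) +
          (∏ _B ∈ blocks (L ^ k) (U \ X), Real.exp (1 / 4)) * (∏ _B ∈ blocks (L ^ k) (X \ U), Real.exp (1 / 4)) *
            (((∏ _B ∈ blocks (L ^ k) X₁, (8 * Real.exp (1 / 4) * τ +
                16 * Real.exp (3 / 8) * hamNorm (fieldWt h (L : ℝ) d k) ((L : ℝ) ^ k) (L ^ (d * k)) (Ht - Ht'))) -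
              ∏ _B ∈ blocks (L ^ k) X₁, 8 * Real.exp (1 / 4) * τ) *
              g (X \ X₁)) +
          (∏ _B ∈ blocks (L ^ k) (U \ X), Real.exp (1 / 4)) * (∏ _B ∈ blocks (L ^ k) (X \ U), Real.exp (1 / 4)) *
            ((∏ _B ∈ blocks (L ^ k) X₁, 8 * Real.exp (1 / 4) * τ) *
              ρ (X \ X₁)))) := by
  set P := abkmNormParams L N Mord R p r₀ h θbar A (schedDelta δ₀ δ₁ N) 𝒞 with hP
  set W := abkmWeightData L N Mord R θbar (schedDelta δ₀ δ₁ N) 𝒞 with hW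
  set s := L ^ k with hs
  set r : ℕ := (2 ^ d - 1) * s with hr
  set 𝓑 := (blocks s (thicken r U)).filter (fun B => B ⊆ thicken r U) with h𝓑
  -- sizes
  have h8 : 8 ≤ 2 ^ (d + 3) := by
    calc 8 = 2 ^ 3 := by norm_num
      _ ≤ 2 ^ (d + 3) := Nat.pow_le_pow_right (by norm_num) (by omega)
  have h2dle : 2 ^ d ≤ 2 ^ (d + 3) := Nat.pow_le_pow_right (by norm_num) (by omega)
  have hL4 : 4 ≤ L := by omega
  have hLR : 2 ^ d + R ≤ L := by omega
  have hd2 : 2 ≤ d := by omega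
  have hL0 : (0 : ℝ) < L := by exact_mod_cast hLodd.pos
  have hkN' : k ≤ N := by omega
  have hk1 : k + 1 ≤ N + 1 := by omega
  obtain ⟨t, ht⟩ : ∃ t, N = k + t := ⟨N - k, by omega⟩
  have hMt : M = s * L ^ t := by rw [hs, ← pow_add, ← ht]; exact hM
  have htodd : Odd (L ^ t) := hLodd.pow
  have hsodd : Odd s := hLodd.pow
  have hMo : Odd M := by rw [hM]; exact hLodd.pow
  have hU' : IsPolymer (L * s) U := by
    rw [show L * s = L ^ (k + 1) by rw [hs, pow_succ']]; exact hU
  have hUk : IsPolymer s U := hU'.of_mul hsodd hLodd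
  -- gauges and radii of the two scales
  have h𝔥k : 0 < P.𝔥 k := fieldWt_pos hh hL0 d k
  have h𝔥 : 0 < P.𝔥 (k + 1) := fieldWt_pos hh hL0 d (k + 1)
  have hsucc : P.𝔥 (k + 1) = scaleRatio d L * P.𝔥 k := fieldWt_succ_nat hLodd.pos d k
  have h𝔥le : P.𝔥 (k + 1) ≤ P.𝔥 k := by
    rw [hsucc]; exact mul_le_of_le_one_left h𝔥k.le (scaleRatio_le_one hd hL4)
  have hRk : 0 < P.R k := by show (0 : ℝ) < (L : ℝ) ^ k; positivity
  have hRle : P.R k ≤ P.R (k + 1) := by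
    show (L : ℝ) ^ k ≤ (L : ℝ) ^ (k + 1)
    exact pow_le_pow_right₀ (by exact_mod_cast hLodd.pos) (by omega)
  have hrad' : P.rad k + (2 ^ d - 1) * P.L ^ k ≤ P.rad (k + 1) := starRad_add_le_succ hLR k
  -- every `X ∈ 𝓧` lies in `U + [−r, r]^d`
  have h𝓧p : ∀ X ∈ 𝓧', IsPolymer s X := fun X hX => (mem_polys.1 (mem_filter.1 (h𝓧' hX)).1).2
  have h𝓧sub : ∀ X ∈ 𝓧', X ⊆ thicken r U := fun X hX => by
    obtain ⟨-, hXU⟩ := mem_filter.1 (h𝓧' hX)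
    rw [← hXU]
    exact TorusPolymer.subset_thicken_reblock hMt hsodd htodd hLodd X
  -- the gauge chain `T_k^{Y*} ≤ T_{k+1}^{U*}` for `Y ⊆ U + [−r,r]^d`
  have hgauge : ∀ Y ⊆ thicken r U, ∀ ξ, ‖P.gauge k Y ξ‖ ≤ ‖P.gauge (k + 1) U ξ‖ := by
    intro Y hY ξ
    have hsub : thicken (P.rad k) Y ⊆ thicken (P.rad (k + 1)) U :=
      (thicken_mono _ hY).trans ((thicken_thicken _ _ _).trans (thicken_mono_rad hrad' _))
    show ‖fieldGauge (P.𝔥 k) (P.R k) P.p (thicken (P.rad k) Y) ξ‖ ≤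
      ‖fieldGauge (P.𝔥 (k + 1)) (P.R (k + 1)) P.p (thicken (P.rad (k + 1)) U) ξ‖
    exact (norm_fieldGauge_mono_set _ _ _ hsub ξ).trans (norm_fieldGauge_mono_weights h𝔥 h𝔥le hRk hRle _ _ ξ)
  -- the block family
  have h𝓑₁ : ∀ X ∈ 𝓧', blocks s (U \ X) ⊆ 𝓑 := fun X hX =>
    blocks_subset_filter_of_subset (hUk.sdiff (h𝓧p X hX)) (sdiff_subset.trans (subset_thicken r U))
  have h𝓑₂ : ∀ X ∈ 𝓧', blocks s (X \ U) ⊆ 𝓑 := fun X hX =>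
    blocks_subset_filter_of_subset ((h𝓧p X hX).sdiff hUk) (sdiff_subset.trans (h𝓧sub X hX))
  have h𝓑₃ : ∀ X ∈ 𝓧', blocks s X ⊆ 𝓑 := fun X hX =>
    blocks_subset_filter_of_subset (h𝓧p X hX) (h𝓧sub X hX)
  have hle : ∀ B ∈ 𝓑, ∀ ξ, ‖P.gauge k B ξ‖ ≤ ‖P.gauge (k + 1) U ξ‖ := fun B hB =>
    hgauge B (mem_filter.1 hB).2
  -- the strong family
  set G : ℕ → Finset (Fin d → ZMod M) → Matrix (Fin d → ZMod M) (Fin d → ZMod M) ℝ :=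
    fun j Y => strongCoef h N j • derivForm (L : ℝ) j (diffIndex d Mord)
      (boxDensity (boxRad R L j) (boxWt (L : ℝ) d j) Y) with hG
  have hW0 : ∀ B φ, 0 ≤ expWeight (G k B) φ := fun B φ => by unfold expWeight; exact (Real.exp_pos _).le
  -- block constants
  have hcard : ∀ x, (blockOf s x).card = L ^ (d * k) := fun x => by
    rw [TorusPolymer.card_blockOf hMt hsodd htodd x, hs, ← pow_mul, mul_comm]
  have hnn : ∀ H₀ : RelevantHamiltonian ℂ d,
      0 ≤ hamNorm (fieldWt h (L : ℝ) d k) ((L : ℝ) ^ k) (L ^ (d * k)) H₀ := fun H₀ =>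
    hamNorm_nonneg (fieldWt_pos hh hL0 d k).le (by positivity) _ H₀
  have hτ0 : 0 ≤ τ := (hnn Ht).trans hHt
  set Δ : ℝ := 16 * Real.exp (3 / 8) * hamNorm (fieldWt h (L : ℝ) d k) ((L : ℝ) ^ k) (L ^ (d * k)) (Ht - Ht')
    with hΔdef
  have hΔ0 : 0 ≤ Δ := by have := hnn (Ht - Ht'); rw [hΔdef]; positivity
  -- the block functionals on a block `B = B_x`
  have hblk : ∀ B ∈ 𝓑, ∃ x, B = blockOf s x := fun B hB => by
    obtain ⟨x, -, rfl⟩ := mem_blocks.1 (mem_filter.1 hB).1; exact ⟨x, rfl⟩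
  have hexp : ∀ (H₀ : RelevantHamiltonian ℂ d), hamNorm (fieldWt h (L : ℝ) d k) ((L : ℝ) ^ k) (L ^ (d * k)) H₀ ≤ 1 / 16 →
      ∀ B ∈ 𝓑, TayNormLE (P.gauge k B) r₀ (expWeight (G k B)) (expNegH H₀ B) (Real.exp (1 / 4)) := by
    intro H₀ hH₀ B hB
    obtain ⟨x, rfl⟩ := hblk B hB
    have h1 : hamNorm (fieldWt h (L : ℝ) d k) ((L : ℝ) ^ k) (blockOf s x).card H₀ ≤ 1 / 8 := by
      rw [hcard x]; linarith
    exact tayNormLE_expNegH_strong_abkm (R := R) (N := N) (Mord := Mord) hd2 hLodd hM hkN' hh hMord hp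
      (subset_thicken (P.rad k) (blockOf s x)) r₀ h1
  have hexpsub : ∀ (H₀ H₀' : RelevantHamiltonian ℂ d),
      hamNorm (fieldWt h (L : ℝ) d k) ((L : ℝ) ^ k) (L ^ (d * k)) H₀ ≤ 1 / 16 →
      hamNorm (fieldWt h (L : ℝ) d k) ((L : ℝ) ^ k) (L ^ (d * k)) H₀' ≤ 1 / 16 →
      ∀ B ∈ 𝓑, TayNormLE (P.gauge k B) r₀ (expWeight (G k B))
        (fun ψ => expNegH H₀ B ψ - expNegH H₀' B ψ)
        (16 * Real.exp (3 / 8) * hamNorm (fieldWt h (L : ℝ) d k) ((L : ℝ) ^ k) (L ^ (d * k)) (H₀ - H₀')) := by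
    intro H₀ H₀' hH₀ hH₀' B hB
    obtain ⟨x, rfl⟩ := hblk B hB
    have h1 : hamNorm (fieldWt h (L : ℝ) d k) ((L : ℝ) ^ k) (blockOf s x).card H₀ ≤ 1 / 16 := by
      rw [hcard x]; exact hH₀
    have h2 : hamNorm (fieldWt h (L : ℝ) d k) ((L : ℝ) ^ k) (blockOf s x).card H₀' ≤ 1 / 16 := by
      rw [hcard x]; exact hH₀'
    have := tayNormLE_expNegH_sub_strong_abkm (R := R) (N := N) (Mord := Mord) hd2 hLodd hM hkN' hh hMord hp
      (subset_thicken (P.rad k) (blockOf s x)) r₀ h1 h2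
    rw [hcard x] at this
    exact this
  have hHt16 : hamNorm (fieldWt h (L : ℝ) d k) ((L : ℝ) ^ k) (L ^ (d * k)) Ht ≤ 1 / 16 := hHt.trans hτ
  have hHt16' : hamNorm (fieldWt h (L : ℝ) d k) ((L : ℝ) ^ k) (L ^ (d * k)) Ht' ≤ 1 / 16 := hHt'.trans hτ
  have hnHt16 : hamNorm (fieldWt h (L : ℝ) d k) ((L : ℝ) ^ k) (L ^ (d * k)) (-Ht) ≤ 1 / 16 := by
    rw [hamNorm_neg]; exact hHt16
  have hnHt16' : hamNorm (fieldWt h (L : ℝ) d k) ((L : ℝ) ^ k) (L ^ (d * k)) (-Ht') ≤ 1 / 16 := by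
    rw [hamNorm_neg]; exact hHt16'
  have hnegsub : hamNorm (fieldWt h (L : ℝ) d k) ((L : ℝ) ^ k) (L ^ (d * k)) (-Ht - -Ht') =
      hamNorm (fieldWt h (L : ℝ) d k) ((L : ℝ) ^ k) (L ^ (d * k)) (Ht - Ht') := by
    rw [show -Ht - -Ht' = -(Ht - Ht') by abel, hamNorm_neg]
  have hswapsub : hamNorm (fieldWt h (L : ℝ) d k) ((L : ℝ) ^ k) (L ^ (d * k)) (Ht' - Ht) =
      hamNorm (fieldWt h (L : ℝ) d k) ((L : ℝ) ^ k) (L ^ (d * k)) (Ht - Ht') := by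
    rw [show Ht' - Ht = -(Ht - Ht') by abel, hamNorm_neg]
  -- slot 1: `e^{−H̃}`
  have hF₁ : ∀ B ∈ 𝓑, TayNormLE (P.gauge k B) r₀ (expWeight (G k B)) (fun φ => expNegH Ht B φ) (Real.exp (1 / 4)) :=
    hexp Ht hHt16
  have hF₁' : ∀ B ∈ 𝓑, TayNormLE (P.gauge k B) r₀ (expWeight (G k B)) (fun φ => expNegH Ht' B φ) (Real.exp (1 / 4)) :=
    hexp Ht' hHt16'
  have hΔ₁ : ∀ B ∈ 𝓑, TayNormLE (P.gauge k B) r₀ (expWeight (G k B))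
      (fun φ => expNegH Ht B φ - expNegH Ht' B φ) Δ := hexpsub Ht Ht' hHt16 hHt16'
  -- slot 2: `e^{+H̃} = e^{−(−H̃)}`
  have hF₂ : ∀ B ∈ 𝓑, TayNormLE (P.gauge k B) r₀ (expWeight (G k B)) (fun φ => expNegH (-Ht) B φ) (Real.exp (1 / 4)) :=
    hexp (-Ht) hnHt16
  have hF₂' : ∀ B ∈ 𝓑, TayNormLE (P.gauge k B) r₀ (expWeight (G k B)) (fun φ => expNegH (-Ht') B φ) (Real.exp (1 / 4)) :=
    hexp (-Ht') hnHt16'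
  have hΔ₂ : ∀ B ∈ 𝓑, TayNormLE (P.gauge k B) r₀ (expWeight (G k B))
      (fun φ => expNegH (-Ht) B φ - expNegH (-Ht') B φ) Δ := by
    intro B hB
    have := hexpsub (-Ht) (-Ht') hnHt16 hnHt16' B hB
    rw [hnegsub] at this
    exact this
  -- slot 3: `1 − e^{−H̃}`
  have hF₃gen : ∀ (H₀ : RelevantHamiltonian ℂ d), hamNorm (fieldWt h (L : ℝ) d k) ((L : ℝ) ^ k) (L ^ (d * k)) H₀ ≤ τ →
      ∀ B ∈ 𝓑, TayNormLE (P.gauge k B) r₀ (expWeight (G k B)) (fun φ => 1 - expNegH H₀ B φ)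
        (8 * Real.exp (1 / 4) * τ) := by
    intro H₀ hH₀ B hB
    obtain ⟨x, rfl⟩ := hblk B hB
    have h1 : hamNorm (fieldWt h (L : ℝ) d k) ((L : ℝ) ^ k) (blockOf s x).card H₀ ≤ 1 / 8 := by
      rw [hcard x]; linarith
    have h0 := tayNormLE_expNegH_sub_one_strong_abkm (R := R) (N := N) (Mord := Mord) hd2 hLodd hM hkN' hh
      hMord hp (subset_thicken (P.rad k) (blockOf s x)) r₀ h1
    rw [hcard x] at h0
    have hcd : ContDiff ℝ r₀ (fun ψ : (Fin d → ZMod M) → ℝ => expNegH H₀ (blockOf s x) ψ - 1) :=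
      ((contDiff_eval H₀ (blockOf s x) (n := r₀)).neg.cexp).sub contDiff_const
    have h2 := h0.smul hcd (-1)
    have hfun : ((-1 : ℝ) • fun ψ : (Fin d → ZMod M) → ℝ => expNegH H₀ (blockOf s x) ψ - 1) =
        fun ψ => 1 - expNegH H₀ (blockOf s x) ψ := by
      funext ψ; simp [neg_sub]
    rw [hfun, abs_neg, abs_one, one_mul] at h2
    refine h2.mono ?_ (hW0 _)
    exact mul_le_mul_of_nonneg_left hH₀ (by positivity)
  have hF₃ := hF₃gen Ht hHt
  have hF₃' := hF₃gen Ht' hHt'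
  have hΔ₃ : ∀ B ∈ 𝓑, TayNormLE (P.gauge k B) r₀ (expWeight (G k B))
      (fun φ => (1 - expNegH Ht B φ) - (1 - expNegH Ht' B φ)) Δ := by
    intro B hB
    have := hexpsub Ht' Ht hHt16' hHt16 B hB
    rw [hswapsub] at this
    have hfun : (fun φ : (Fin d → ZMod M) → ℝ => (1 - expNegH Ht B φ) - (1 - expNegH Ht' B φ)) =
        fun φ => expNegH Ht' B φ - expNegH Ht B φ := by
      funext φ; ring
    rw [hfun]
    exact this
  -- smoothness and locality of the block functionals
  have hcdE : ∀ (H₀ : RelevantHamiltonian ℂ d), ∀ B ∈ 𝓑, ContDiff ℝ r₀ (fun φ : (Fin d → ZMod M) → ℝ => expNegH H₀ B φ) :=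
    fun H₀ B _ => (contDiff_eval H₀ B (n := r₀)).neg.cexp
  have hcd3 : ∀ (H₀ : RelevantHamiltonian ℂ d), ∀ B ∈ 𝓑,
      ContDiff ℝ r₀ (fun φ : (Fin d → ZMod M) → ℝ => 1 - expNegH H₀ B φ) :=
    fun H₀ B _ => contDiff_const.sub (contDiff_eval H₀ B (n := r₀)).neg.cexp
  have hlocE : ∀ (H₀ : RelevantHamiltonian ℂ d), ∀ B ∈ 𝓑,
      IsGaugeLocal (P.gauge k B) (fun φ : (Fin d → ZMod M) → ℝ => expNegH H₀ B φ) :=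
    fun H₀ B _ => isGaugeLocal_cexp_neg_eval h𝔥k.ne' hRk.ne' hp (subset_thicken _ _) H₀
  have hloc3 : ∀ (H₀ : RelevantHamiltonian ℂ d), ∀ B ∈ 𝓑,
      IsGaugeLocal (P.gauge k B) (fun φ : (Fin d → ZMod M) → ℝ => 1 - expNegH H₀ B φ) :=
    fun H₀ B hB => IsGaugeLocal.op₁ _ (fun z : ℂ => 1 - z) (hlocE H₀ B hB)
  have ha : ∀ B ∈ 𝓑, (0 : ℝ) ≤ Real.exp (1 / 4) := fun _ _ => (Real.exp_pos _).le
  have ha₃ : ∀ B ∈ 𝓑, (0 : ℝ) ≤ 8 * Real.exp (1 / 4) * τ := fun _ _ => by positivity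
  have hδ : ∀ B ∈ 𝓑, (0 : ℝ) ≤ Δ := fun _ _ => hΔ0
  have hlep : ∀ X ∈ 𝓧', ∀ X₁ ∈ 𝓨 X, ∀ ξ, ‖P.gauge k (X \ X₁) ξ‖ ≤ ‖P.gauge (k + 1) U ξ‖ :=
    fun X hX X₁ _ => hgauge (X \ X₁) (sdiff_subset.trans (h𝓧sub X hX))
  -- the weight inequality
  have hGs : W.StrongDominated G fun _ X Y => Disjoint X Y :=
    hB.strong (diffIndex d Mord) (fun α hα => hα) (strongCoef h N) (strongCoef_le hδ₀ hδ₁ hh hh0)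
  have hrstar : r ≤ starRad R L d (k + 1) := by
    have : P.rad (k + 1) = starRad R L d (k + 1) := rfl
    have h' : (2 ^ d - 1) * P.L ^ k ≤ P.rad (k + 1) := le_trans (Nat.le_add_left _ _) hrad'
    rw [hr, hs]; exact h'
  have hrplus : r ≤ plusRad R L (k + 1) := by
    show (2 ^ d - 1) * L ^ k ≤ L ^ (k + 1)
    rw [pow_succ']
    exact Nat.mul_le_mul_right _ (by omega)
  have hw : ∀ X ∈ 𝓧', ∀ X₁ ∈ 𝓨 X, ∀ φ, (∏ B ∈ blocks s (U \ X), expWeight (G k B) φ) *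
      (∏ B ∈ blocks s (X \ U), expWeight (G k B) φ) *
      ((∏ B ∈ blocks s X₁, expWeight (G k B) φ) * W.midWeight k (X \ X₁) φ) ≤ W.weight (k + 1) U φ := by
    intro X hX X₁ hX₁ φ
    have hXp := h𝓧p X hX
    obtain ⟨hX₁X, hX₁p⟩ := mem_polys.1 (h𝓨 X hX hX₁)
    have hZp : IsPolymer s (U \ X ∪ X \ U) := (hUk.sdiff hXp).union (hXp.sdiff hUk)
    have hdisj : Disjoint (blocks s (U \ X)) (blocks s (X \ U)) :=
      (hUk.sdiff hXp).disjoint_blocks (hXp.sdiff hUk) (Finset.sdiff_disjoint.mono_right sdiff_subset)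
    have hprod : (∏ B ∈ blocks s (U \ X), expWeight (G k B) φ) * (∏ B ∈ blocks s (X \ U), expWeight (G k B) φ) =
        ∏ B ∈ blocks s (U \ X ∪ X \ U), expWeight (G k B) φ := by
      rw [TorusPolymer.blocks_union, prod_union hdisj]
    have hZU : U \ X ∪ X \ U ⊆ thicken (plusRad R L (k + 1)) U :=
      union_subset (sdiff_subset.trans (subset_thicken _ U))
        (sdiff_subset.trans ((h𝓧sub X hX).trans (thicken_mono_rad hrplus U)))
    have hX₁U : X₁ ⊆ thicken (plusRad R L (k + 1)) U :=
      hX₁X.trans ((h𝓧sub X hX).trans (thicken_mono_rad hrplus U))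
    have hX₂U : X \ X₁ ⊆ thicken (starRad R L d (k + 1)) U :=
      sdiff_subset.trans ((h𝓧sub X hX).trans (thicken_mono_rad hrstar U))
    have hmain := prod_strongWeight_sq_mul_midWeight_le_abkm hB hLodd hL hR2 hM hkN hδ₀ hδ₁ hh hh0 hU hX₂U hZp hZU
      hX₁p hX₁U φ
    calc (∏ B ∈ blocks s (U \ X), expWeight (G k B) φ) * (∏ B ∈ blocks s (X \ U), expWeight (G k B) φ) *
          ((∏ B ∈ blocks s X₁, expWeight (G k B) φ) * W.midWeight k (X \ X₁) φ)
        = (∏ B ∈ blocks s (U \ X ∪ X \ U), expWeight (G k B) φ) *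
            (∏ B ∈ blocks s X₁, expWeight (G k B) φ) * W.midWeight k (X \ X₁) φ := by
          rw [← hprod]; ring
      _ ≤ W.weight (k + 1) U φ := hmain
  -- assemble (all implicit data given explicitly, so that no metavariable sits under the binders)
  have key := tayNormLE_subsum_reblockTerm_sub s (P.gauge (k + 1) U) (fun B => P.gauge k B) (fun Y => P.gauge k Y)
    (r₀ := r₀) (W := fun B => expWeight (G k B)) (wm := fun Y => W.midWeight k Y) (w := W.weight (k + 1) U)
    (F₁ := fun B φ => expNegH Ht B φ) (F₂ := fun B φ => expNegH (-Ht) B φ) (F₃ := fun B φ => 1 - expNegH Ht B φ)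
    (F₁' := fun B φ => expNegH Ht' B φ) (F₂' := fun B φ => expNegH (-Ht') B φ)
    (F₃' := fun B φ => 1 - expNegH Ht' B φ)
    (G := Gs) (G' := Gs')
    (a₁ := fun _ => Real.exp (1 / 4)) (a₂ := fun _ => Real.exp (1 / 4)) (a₃ := fun _ => 8 * Real.exp (1 / 4) * τ)
    (δ₁ := fun _ => Δ) (δ₂ := fun _ => Δ) (δ₃ := fun _ => Δ)
    (g := g) (ρ := ρ)
    𝓧' 𝓑 𝓨 hUk h𝓧p h𝓨 h𝓑₁ h𝓑₂ h𝓑₃ hle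
    hF₁ hF₁' hΔ₁ (hcdE Ht) (hcdE Ht') (hlocE Ht) (hlocE Ht') ha hδ
    hF₂ hF₂' hΔ₂ (hcdE (-Ht)) (hcdE (-Ht')) (hlocE (-Ht)) (hlocE (-Ht')) ha hδ
    hF₃ hF₃' hΔ₃ (hcd3 Ht) (hcd3 Ht') (hloc3 Ht) (hloc3 Ht') ha₃ hδ
    hSlot hSlotΔ hSlotd hSlotd' hSlotloc hSlotloc' hSlotg hSlotρ hlep hw
  exact key

end Literature.MathematicalPhysics.StatisticalMechanics.GradientRG

end
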